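import Summits.QuantumFields.BalabanUV.Beta.FP.FineSplitJunction

/-!
# `BalabanUV.Beta.FP.FineSplitJunctionBiVertex` — road «FP» for binder row D1, row KER-γ «THE JUNCTION», SOCKET (α0), sequel of `FP/FineSplitJunction`:
# THE BI-VERTEX SECOND-ORDER SLOT — (ASYMP) for `T m := TPerfOf (Lc^m) (KPerf…m) (S m) (vertex2OfK (KPerf…m) (Lc^m) (Wf m))` MODULO a FINE split of the
# FULL fine kernel `fineHessA (Π KPerf Π) (Πᵀ S) Wf` against `(Lc^m)⁸·truncK PiBF (Lc^m) c e (s′−s)`, the piece ledger, the H2V-4 letters and the colour equation;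
# the sandwich hypothesis of `FineSplitJunction.hasym_PiBF_of_fineSplit` DISCHARGED by `PerfectFullSandwich.TPerfOf_vertex2OfK_eq_dressedEntryP`

HONEST DEPENDENCY (page 1, mandatory): continuum YM on T⁴ ⇐ BetaPertH ∧ nine spine estimates (0/9 proved); BetaPertH ⇐ (D1) ∧ (D4) ∧
CAP+tail; G-an2-4 gates asym, D1 and NE2/3/4.  HONEST FRAMING (cell contract, verbatim): «discharging `BetaPertH` makes Bałaban's UV
stability UNCONDITIONAL — a real constructive-QFT result; it is NOT the continuum limit and NOT the Clay problem.»  THIS MODULE is [folklore]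
bookkeeping composed BY NAME: `FineSplitJunction.hasym_PiBF_of_fineSplit` (this seat), `PerfectFullSandwich.TPerfOf_vertex2OfK_eq_dressedEntryP` and the
K-side letters of the perfect resolvent `StepLawKHolds.exists_decays_KPerf_holds`, `SymmetryK.shiftK_KPerf`, `PerfectBubbleSandwich.entryHyps_perfCol_zero`.
No `def`, no `def … : Prop`, nothing cited, nothing of the manuscripts under audit asserted, 0 sorry.  WHAT IT IS NOT: whether road FP's perfect table
`WPerfOf` HAS the bi-vertex form `vertex2OfK K n Wf (+ mixed ∕ response summands)` is leaf N0b-W (open) — NOT asserted; not the fine split (KER-γ (α2)(γ)),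
not the piece ledger (rem), not H2V-4; hence NOT (ASYMP) for the literal, NOT D1; 0∕4 row-D1 binders; NOT BetaPertH, NOT continuum, NOT Clay.

ABSOLUTE RULE (cell charter, verbatim): «No internally-minted statement may enter as a cited fact. Every hypothesis is either kernel-proved in this
package or a verbatim quotation of a PUBLISHED theorem with page reference. The manuscript(s) under audit are NOT citable for their own disputed
steps — they are the thing under adjudication; programme-internal (2001/route/tribunal) claims are never citable.»

CONTENT ([folklore]): **`hasym_PiBF_vertex2OfK_of_fineSplit`**.
Provenance: D1 formalisation swarm LEAF PROVER 01, unit `b2b-balaban-beta-d1-formalise-leaf-01` gen 11 (prover-b2b-balaban-beta-d1-formalise-leaf-01-g11-0),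
2026-08-21, road FP row KER-γ (R-FP-31 ∕ R-FP-33 (c)); «not in print; our bookkeeping».
-/

noncomputable section

namespace Summit.QuantumFields.BalabanUV.Beta.FP.FineSplitJunctionBiVertex

open Finset
open scoped BigOperators
open Literature.MathematicalPhysics.QuantumFieldTheory.Balaban1983to89
open Literature.MathematicalPhysics.QuantumFieldTheory.Balaban1983to89.Beta
open Literature.MathematicalPhysics.QuantumFieldTheory.Balaban1983to89.Beta.BubbleTransfer (c4)
open Literature.MathematicalPhysics.QuantumFieldTheory.Balaban1983to89.B12Normalization (stepBal)
open B12Sec2to5 (l1)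
open PolarizationSign (reflSign)
open ExpKernelCalculus (Site MKer BiLoc comp shiftK)
open OneStepResolventKernel (Fib LocStencil)
open OneStepKernelFamily (colH)
open KernelWard (divV divW)
open KernelReflection (LegMap refK bondRefl)
open DyadicShell (Pt supNorm)
open LeadingCoefficient (kappaBal)
open AxialProjector (coProj)
open AxialDressing (axDressK)
open SecondOrderResponse (vertex2OfK)
open Summit.QuantumFields.BalabanUV.Beta.GAN24.CombesThomas (sfStep smStep)
open Summit.QuantumFields.BalabanUV.Beta.D1BFx.MomentTransferPeriodicEntry (EKer₂ dressedEntryP)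
open Summit.QuantumFields.BalabanUV.Beta.D1BFx.ReducedKernelSandwichLeg (fineHessA)
open Summit.QuantumFields.BalabanUV.Beta.FP.PerfectObjectsT (KPerf TPerfOf)
open Summit.QuantumFields.BalabanUV.Beta.FP.HorizontalBookkeeping (truncK)
open Summit.QuantumFields.BalabanUV.Beta.FP.WilsonCubicGerm (cubicGermOf)
open Summit.QuantumFields.BalabanUV.Beta.FP.GhostCubicGerm (cubicGermOfSc)
open Summit.QuantumFields.BalabanUV.Beta.FP.BubbleGermValue (bfGerm ghostGerm)
open Summit.QuantumFields.BalabanUV.Beta.FP.PerfectPolarization (Pker G0ker PiBF)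
open Summit.QuantumFields.BalabanUV.Beta.FP.StepLawKHolds (exists_decays_KPerf_holds)
open Summit.QuantumFields.BalabanUV.Beta.FP.SymmetryK (shiftK_KPerf)
open Summit.QuantumFields.BalabanUV.Beta.FP.PerfectBubbleSandwich (entryHyps_perfCol_zero)
open Summit.QuantumFields.BalabanUV.Beta.FP.PerfectFullSandwich (TPerfOf_vertex2OfK_eq_dressedEntryP)
open Summit.QuantumFields.BalabanUV.Beta.FP.FineSplitJunction (hasym_PiBF_of_fineSplit)

/-! ## The bi-vertex slot: the sandwich hypothesis discharged -/

section BiVertex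

variable {Lc : ℕ} [NeZero Lc]

/-- **(ASYMP) FOR THE PERFECT ONE-LOOP KERNEL WITH THE BI-VERTEX SECOND-ORDER SLOT, MODULO A FINE SPLIT AND THE PIECE LEDGER** [our object]:
`T m := TPerfOf (Lc^m) (KPerf…m) (S m) (vertex2OfK (KPerf…m) (Lc^m) (Wf m))` for ANY local, coarse-covariant first-order stencil families `S m` and ANY
bi-localised, coarse-covariant bi-tables `Wf m` (constants free per `m`); the sandwich hypothesis of §4 is DISCHARGED by
`PerfectFullSandwich.TPerfOf_vertex2OfK_eq_dressedEntryP` with the FULL fine kernel `F m := fineHessA (axDressK (Lc^m) (KPerf…m)) (coProj (Lc^m) (S m)) (Wf m)`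
(K-side letters `exists_decays_KPerf_holds`, `shiftK_KPerf`, `entryHyps_perfCol_zero`).  What remains displayed: the admissible-family letters and germ
identities of `PiBF`'s vertex data (row H2V-4), the colour equation, the FINE split `hfine` of `F m` against `(Lc^m)⁸·truncK PiBF (Lc^m) c e (s′ − s)`
into bounded pieces (KER-γ (α2)(γ)) and the piece ledger (rem).  Whether road FP's `WPerfOf` HAS this bi-vertex form is leaf N0b-W (open) — NOT asserted. -/
theorem hasym_PiBF_vertex2OfK_of_fineSplit (hLc : 2 ≤ Lc) (wg wgh : ℝ)
    {V : Fin 4 → Site 4 → MKer 4 (Fib 3)} {W : Fin 4 → Site 4 → Fin 4 → Site 4 → MKer 4 (Fib 3)}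
    {v : Fin 4 → Site 4 → MKer 4 Unit} {w : Fin 4 → Site 4 → Fin 4 → Site 4 → MKer 4 Unit} {Cv Cw Cx Cw' Cx' CwL CwL' cQ δ : ℝ} (hδ : 0 < δ)
    -- admissible-family letters, gluon sector
    (hV : ∀ (μ : Fin 4) (y : Site 4), BiLoc (V μ y) y y Cv δ) (hW : ∀ (μ : Fin 4) (y : Site 4) (ν : Fin 4) (y' : Site 4), BiLoc (W μ y ν y') y y' Cw δ)
    (hcovV : ∀ (μ : Fin 4) (y t : Site 4), V μ (y + t) = shiftK (-t) (V μ y))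
    (hcovW : ∀ (μ : Fin 4) (y : Site 4) (ν : Fin 4) (y' t : Site 4), W μ (y + t) ν (y' + t) = shiftK (-t) (W μ y ν y'))
    (X : Site 4 → MKer 4 (Fib 3)) (hX : ∀ y, BiLoc (X y) y y Cx δ)
    (hW1 : ∀ y, comp (comp Pker (divV V y)) Pker = comp Pker (X y) - comp (X y) Pker)
    (hW2 : ∀ y ν y', divW W y ν y' = comp (X y) (V ν y') - comp (V ν y') (X y))
    (hreflP : ∀ α : Fin 4, ∃ Φα : LegMap 4 (Fib 3), refK Φα Pker = Pker ∧ ∃ c : ℤ,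
      (∀ μ y, V μ (bondRefl α c μ y) = reflSign α μ • refK Φα (V μ y)) ∧
      (∀ μ y ν y', W μ (bondRefl α c μ y) ν (bondRefl α c ν y') = (reflSign α μ * reflSign α ν) • refK Φα (W μ y ν y')))
    (h0V : ∀ (lam α β : Fin 4), ∑' p : Pt × Pt, V lam 0 p.1 p.2 (Sum.inl α) (Sum.inl β) = 0)
    (hgermV : cubicGermOf V = cQ • bfGerm)
    (hWloc : ∀ (μ ν : Fin 4) (z : Pt), BiLoc (W μ 0 ν z) 0 z (CwL * Real.exp (-δ * l1 z)) δ)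
    -- admissible-family letters, ghost sector
    (hv : ∀ (μ : Fin 4) (y : Site 4), BiLoc (v μ y) y y Cv δ) (hw : ∀ (μ : Fin 4) (y : Site 4) (ν : Fin 4) (y' : Site 4), BiLoc (w μ y ν y') y y' Cw' δ)
    (hcovv : ∀ (μ : Fin 4) (y t : Site 4), v μ (y + t) = shiftK (-t) (v μ y))
    (hcovw : ∀ (μ : Fin 4) (y : Site 4) (ν : Fin 4) (y' t : Site 4), w μ (y + t) ν (y' + t) = shiftK (-t) (w μ y ν y'))
    (Xg : Site 4 → MKer 4 Unit) (hXg : ∀ y, BiLoc (Xg y) y y Cx' δ)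
    (hW1g : ∀ y, comp (comp G0ker (divV v y)) G0ker = comp G0ker (Xg y) - comp (Xg y) G0ker)
    (hW2g : ∀ y ν y', divW w y ν y' = comp (Xg y) (v ν y') - comp (v ν y') (Xg y))
    (hreflG : ∀ α : Fin 4, ∃ Ψα : LegMap 4 Unit, refK Ψα G0ker = G0ker ∧ ∃ c : ℤ,
      (∀ μ y, v μ (bondRefl α c μ y) = reflSign α μ • refK Ψα (v μ y)) ∧
      (∀ μ y ν y', w μ (bondRefl α c μ y) ν (bondRefl α c ν y') = (reflSign α μ * reflSign α ν) • refK Ψα (w μ y ν y')))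
    (h0v : ∀ lam : Fin 4, ∑' p : Pt × Pt, v lam 0 p.1 p.2 () () = 0)
    (hgermv : cubicGermOfSc v = ghostGerm)
    (hwloc : ∀ (μ ν : Fin 4) (z : Pt), BiLoc (w μ 0 ν z) 0 z (CwL' * Real.exp (-δ * l1 z)) δ)
    -- the colour weights and the entry
    {N : ℝ} (hn : (40 * wg * (1 / 4 : ℝ) * (c4 * cQ) ^ 2 - wgh * (-(1 / 2 : ℝ)) * c4 ^ 2) / 3 = kappaBal N)
    {μ ν : Fin 4} (hμν : μ ≠ ν)
    -- the road's first-order stencils and bi-tables at every `m` (letters per `m`, constants free)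
    {S : ℕ → Fin (3 + 1) → (Fin (3 + 1) → ℤ) → MKer (3 + 1) (Fib 3)}
    (hS : ∀ m : ℕ, 1 ≤ m → ∃ Cs δs : ℝ, 0 < δs ∧ LocStencil (S m) Cs δs ∧
      ∀ κ u t, S m κ (u + ((Lc ^ m : ℕ) : ℤ) • t) = shiftK (-(((Lc ^ m : ℕ) : ℤ) • t)) (S m κ u))
    {Wf : ℕ → Fin (3 + 1) → (Fin (3 + 1) → ℤ) → Fin (3 + 1) → (Fin (3 + 1) → ℤ) → MKer (3 + 1) (Fib 3)}
    (hWf : ∀ m : ℕ, 1 ≤ m → ∃ C2 δ2 : ℝ, 0 < δ2 ∧ (∀ κ' u l' u', BiLoc (Wf m κ' u l' u') u u' C2 δ2) ∧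
      ∀ κ' u l' u' t, Wf m κ' (u + ((Lc ^ m : ℕ) : ℤ) • t) l' (u' + ((Lc ^ m : ℕ) : ℤ) • t)
        = shiftK (-(((Lc ^ m : ℕ) : ℤ) • t)) (Wf m κ' u l' u'))
    -- the FINE split of the full fine kernel against the transported `PiBF`, bounded pieces, and the piece ledger
    {ι : Type*} (I : Finset ι) {G : ι → ℕ → EKer₂ 4} {B : ι → ℝ}
    (hfine : ∀ m : ℕ, 1 ≤ m → ∀ (c e : Fin 4) (s s' : Pt),
      fineHessA (axDressK (Lc ^ m) (KPerf (d := 3) Lc (sfStep Lc) (smStep 3 Lc) m)) (coProj (Lc ^ m) (S m)) (Wf m) c e s s'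
        - ((Lc ^ m : ℕ) : ℝ) ^ 8 * truncK (PiBF wg wgh V W v w) (Lc ^ m) c e (s' - s) = ∑ i ∈ I, G i m c e s s')
    (hGb : ∀ i ∈ I, ∀ m : ℕ, 1 ≤ m → ∀ c e : Fin 4, ∃ A, ∀ s s', |G i m c e s s'| ≤ A)
    (hpieces : ∀ i ∈ I, ∀ m : ℕ, 1 ≤ m → ∀ S' : Finset Pt, ∑ u ∈ S', (supNorm u : ℝ) ^ 2 *
      |dressedEntryP (fun c a => colH (KPerf (d := 3) Lc (sfStep Lc) (smStep 3 Lc) m) (Lc ^ m) a 0 c) (G i m)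
        (((Lc ^ m : ℕ) : ℤ) • (-u)) μ ν| ≤ B i) :
    ∃ U₀ : ℝ, 0 ≤ U₀ ∧ ∃ Cg : ℝ, ∀ m : ℕ, 1 ≤ m →
      |B12Beta.secondMoment (TPerfOf (Lc ^ m) (KPerf (d := 3) Lc (sfStep Lc) (smStep 3 Lc) m) (S m)
          (vertex2OfK (KPerf (d := 3) Lc (sfStep Lc) (smStep 3 Lc) m) (Lc ^ m) (Wf m))) μ ν - (m : ℝ) * stepBal N Lc|
        ≤ (U₀ + ∑ i ∈ I, B i) + Cg := by
  -- the sandwich at every `m`, K-side letters from the tree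
  have hsand : ∀ m : ℕ, 1 ≤ m → ∀ u : Pt,
      TPerfOf (Lc ^ m) (KPerf (d := 3) Lc (sfStep Lc) (smStep 3 Lc) m) (S m)
          (vertex2OfK (KPerf (d := 3) Lc (sfStep Lc) (smStep 3 Lc) m) (Lc ^ m) (Wf m)) μ ν u
        = dressedEntryP (fun c a => colH (KPerf (d := 3) Lc (sfStep Lc) (smStep 3 Lc) m) (Lc ^ m) a 0 c)
          (fineHessA (axDressK (Lc ^ m) (KPerf (d := 3) Lc (sfStep Lc) (smStep 3 Lc) m)) (coProj (Lc ^ m) (S m)) (Wf m))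
          (((Lc ^ m : ℕ) : ℤ) • (-u)) μ ν := by
    intro m hm u
    have hn1 : 1 ≤ Lc ^ m := Nat.one_le_pow _ _ (by omega)
    obtain ⟨CK, δK, hδK, hK⟩ := exists_decays_KPerf_holds hLc hm
    obtain ⟨Cs, δs, hδs, hSm, hScov⟩ := hS m hm
    obtain ⟨C2, δ2, hδ2, hWm, hWcov⟩ := hWf m hm
    have h := TPerfOf_vertex2OfK_eq_dressedEntryP (n := Lc ^ m) hn1 hK hδK (fun t => shiftK_KPerf Lc (sfStep Lc) (smStep 3 Lc) m t)
      (entryHyps_perfCol_zero hLc hm).absW hSm hδs (by exact_mod_cast hScov) hWm hδ2 (by exact_mod_cast hWcov) μ ν u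
    simpa using h
  exact hasym_PiBF_of_fineSplit hLc wg wgh hδ hV hW hcovV hcovW X hX hW1 hW2 hreflP h0V hgermV hWloc hv hw hcovv hcovw Xg hXg hW1g hW2g
    hreflG h0v hgermv hwloc hn hμν
    (T := fun m => TPerfOf (Lc ^ m) (KPerf (d := 3) Lc (sfStep Lc) (smStep 3 Lc) m) (S m)
      (vertex2OfK (KPerf (d := 3) Lc (sfStep Lc) (smStep 3 Lc) m) (Lc ^ m) (Wf m)))
    (F := fun m => fineHessA (axDressK (Lc ^ m) (KPerf (d := 3) Lc (sfStep Lc) (smStep 3 Lc) m)) (coProj (Lc ^ m) (S m)) (Wf m))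
    I hsand hfine hGb hpieces

end BiVertex

end Summit.QuantumFields.BalabanUV.Beta.FP.FineSplitJunctionBiVertex

end
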